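import Literature.Analysis.FluidPDE.PeriodicLogSliceDrift
import Literature.Analysis.FluidPDE.PeriodicTestedSlice
import Literature.Analysis.FluidPDE.PeriodicSwirlMoserStep
import Literature.Analysis.FluidPDE.LeiZhang2011LowerMassCore
import HarnessLib

/-!
# Lei–Ren–Zhang 2019, Lemma 3.3: the lower bound of the axis boundary term per period (analytic core)

Analysis/FluidPDE proofs file (theorems only, no definitions, no named facts), on the discharge
path of the named fact `Literature.Analysis.FluidPDE.leiRenZhang2019_liouville_periodic`
(Z. Lei, X. Ren, Q. S. Zhang, arXiv:1902.11229 = Math. Ann. 383 (2022), Theorem 1.1). Lemma 3.3 of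
the paper (arXiv p. 8): for a nonnegative `z`-periodic solution `Φ` of the swirl-type equation on
`P_R` with `Φ|_{r=0} ≥ ½`, `‖Φ‖_{L¹(P_R)} ≥ κR⁴`. The proof tests the equation with
`½Φ^{-1/2}ψ_R²` ((3.13)): the axis term produces the positive boundary contribution
"`−2∭√Φ|_{r=0}ψ² dθ dz dt`" ((3.14)), the drift term is handled through the angular stream
function and absorbed ((3.15): "`∫ b·∇√Φ ψ² ≤ ∫|∇Φ^{1/4}|²ψ² + C∫√Φ(∂ᵣψ)²`"), and all remaining
terms are `≲ R⁻² ∫ √Φ`. This file is the periodic twin of `LeiZhang2011.lower_mass_core`: the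
computation is run through `energy_identity_axis_periodic` with a time cut-off vanishing at both
ends, for a positive `H ∈ C²` with a continuous weight `G_w ≥ 0`, `H'² ≤ κ H G_w`, and
`H''(F) = −G_w(F)` on the cylinder (`H = v^p`, `p < 1`).

* `abs_viscous_cutoff_term_le_weight_periodic` — the cut-off part of the viscous term per period
  with the general weight: `|∫_{slab} H'(F)⟪∇F, ∇ψ²⟫| ≤ ε∫_{slab} G_w(F)‖∇F‖²ψ² + (κ/ε)∫_{slab} H(F)‖∇ψ‖²`;
* `abs_drift_term_le_weight_periodic` — the drift term per period with the general weight
  ((3.15)): `|∫_{slab} H(F)⟪b, ∇ψ²⟫| ≤ ε∫_{slab} G_w(F)‖∇F‖²ψ² + (κC_Φ²/ε)∫_{slab} H(F)‖∇ψ‖²`;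
* `lower_mass_core_periodic` — the time integral of the axis boundary term
  `η · 2c₂ ψ(0)² ∫_0^P H(F(s,0,0,z)) dz` is at most
  `∫ (4κD²(1 + C_Φ²) + C_ax + D') ∫_{[0,P]×{r≤ρ}} H(F(s)) ds`.

## References

* Z. Lei, X. Ren, Q. S. Zhang, arXiv:1902.11229, §3, Lemma 3.3 and its proof, (3.13)–(3.15)
  (arXiv p. 8). [LeiRenZhang2019]
* Z. Lei, Q. S. Zhang, arXiv:1011.5066, Lemma 3.4 (p. 11) (tree `LeiZhang2011.lower_mass_core`).
  [LeiZhang2011]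
-/

noncomputable section

open MeasureTheory Set Function Filter Metric intervalIntegral
open _root_.Topology
open scoped InnerProductSpace RealInnerProductSpace NNReal ENNReal Laplacian

namespace Literature.Analysis.FluidPDE

namespace LeiRenZhang2019

open LeiZhang2011

/-! ### Plumbing (copies of the private helpers of `PeriodicLogSliceDrift`) -/

/-- `‖e_z‖ = 1`. [folklore] -/
private theorem norm_eZ_plm : ‖(eZ : EuclideanSpace ℝ (Fin 3))‖ = 1 := by
  have h : (eZ : EuclideanSpace ℝ (Fin 3)) = PiLp.single 2 (2 : Fin 3) (1 : ℝ) := rfl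
  rw [h, PiLp.norm_single, norm_one]

/-- Unfolding of axial periodicity with `eZ`. [folklore] -/
private theorem periodic_apply_plm {α : Sort*} {P : ℝ} {Q : EuclideanSpace ℝ (Fin 3) → α}
    (hQ : IsAxiallyPeriodic P Q) (x : EuclideanSpace ℝ (Fin 3)) : Q (x + P • eZ) = Q x :=
  hQ x

/-- Axial periodicity from its `eZ` form. [folklore] -/
private theorem periodic_of_eZ_plm {α : Sort*} {P : ℝ} {Q : EuclideanSpace ℝ (Fin 3) → α}
    (hQ : ∀ x : EuclideanSpace ℝ (Fin 3), Q (x + P • eZ) = Q x) : IsAxiallyPeriodic P Q :=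
  hQ

/-- A function invariant under all axial translations is axially periodic. [folklore] -/
private theorem periodic_of_forall_add_smul_plm {α : Sort*} {P : ℝ} {c : EuclideanSpace ℝ (Fin 3) → α}
    (hc : ∀ (x : EuclideanSpace ℝ (Fin 3)) (t : ℝ), c (x + t • eZ) = c x) : IsAxiallyPeriodic P c :=
  fun x => hc x P

/-- The derivative of a periodic function is periodic. [folklore] -/
private theorem periodic_fderiv_plm {P : ℝ} {f : EuclideanSpace ℝ (Fin 3) → ℝ}
    (hf : IsAxiallyPeriodic P f) : IsAxiallyPeriodic P (fderiv ℝ f) := by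
  intro x
  have hfun : (fun y => f (y + P • EuclideanSpace.single (2 : Fin 3) (1 : ℝ))) = f := funext hf
  have h := fderiv_comp_add_right (𝕜 := ℝ) (f := f) (x := x)
    (P • EuclideanSpace.single (2 : Fin 3) (1 : ℝ))
  rw [hfun] at h
  exact h.symm

/-- **The axial derivative of a `z`-invariant function vanishes.** [folklore] -/
private theorem fderiv_eZ_eq_zero_of_forall_add_smul_plm {c : EuclideanSpace ℝ (Fin 3) → ℝ}
    {x : EuclideanSpace ℝ (Fin 3)} (hcd : DifferentiableAt ℝ c x)
    (hc : ∀ t : ℝ, c (x + t • eZ) = c x) : fderiv ℝ c x eZ = 0 := by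
  have hline : HasDerivAt (fun t : ℝ => x + t • (eZ : EuclideanSpace ℝ (Fin 3))) eZ 0 := by
    have h := ((hasDerivAt_id (0 : ℝ)).smul_const (eZ : EuclideanSpace ℝ (Fin 3))).const_add x
    simpa using h
  have hx0 : x + (0 : ℝ) • (eZ : EuclideanSpace ℝ (Fin 3)) = x := by simp
  have hcd' : DifferentiableAt ℝ c (x + (0 : ℝ) • (eZ : EuclideanSpace ℝ (Fin 3))) := by rwa [hx0]
  have hcomp := hcd'.hasFDerivAt.comp_hasDerivAt (0 : ℝ) hline
  rw [hx0] at hcomp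
  have hconst : HasDerivAt (fun t : ℝ => c (x + t • (eZ : EuclideanSpace ℝ (Fin 3)))) 0 0 := by
    have : (fun t : ℝ => c (x + t • (eZ : EuclideanSpace ℝ (Fin 3)))) = fun _ => c x := funext hc
    rw [this]
    exact hasDerivAt_const _ _
  exact hcomp.unique hconst

/-- `|∂_z F| ≤ ‖∇F‖`. [folklore] -/
private theorem abs_fderiv_eZ_le_norm_gradient_plm (F : EuclideanSpace ℝ (Fin 3) → ℝ)
    (x : EuclideanSpace ℝ (Fin 3)) : |fderiv ℝ F x eZ| ≤ ‖gradient F x‖ := by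
  rw [← inner_gradient_left, ← Real.norm_eq_abs]
  calc ‖⟪gradient F x, eZ⟫‖ ≤ ‖gradient F x‖ * ‖(eZ : EuclideanSpace ℝ (Fin 3))‖ := norm_inner_le_norm _ _
    _ = ‖gradient F x‖ := by rw [norm_eZ_plm, mul_one]

/-- `∇(φ²) = 2φ ∇φ`. [folklore] -/
private theorem gradient_sq_plm {φ : EuclideanSpace ℝ (Fin 3) → ℝ} {x : EuclideanSpace ℝ (Fin 3)}
    (hd : DifferentiableAt ℝ φ x) : gradient (fun y => φ y ^ 2) x = (2 * φ x) • gradient φ x := by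
  have h := gradient_comp_apply (H := fun t : ℝ => t ^ 2) (F := φ) ((differentiable_pow 2) (φ x)) hd
  simp only [deriv_pow_field, Nat.cast_ofNat, Nat.add_one_sub_one, pow_one] at h
  exact h

/-- The periodic window is supported in `|z| ≤ 2P`. [folklore] -/
private theorem abs_le_of_periodicWindow_ne_zero_plm {P : ℝ} (hP : 0 < P) (z : ℝ)
    (hz : periodicWindow P z ≠ 0) : |z| ≤ 2 * P := by
  have h := mem_Ioo_of_periodicWindow_ne_zero hP hz
  rw [abs_le]
  exact ⟨by linarith [h.1], h.2.le⟩

/-- The squared window is supported in `|z| ≤ 2P`. [folklore] -/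
private theorem abs_le_of_periodicWindow_sq_ne_zero_plm {P : ℝ} (hP : 0 < P) (z : ℝ)
    (hz : periodicWindow P z ^ 2 ≠ 0) : |z| ≤ 2 * P :=
  abs_le_of_periodicWindow_ne_zero_plm hP z fun h => hz (by rw [h]; ring)

/-- A function vanishing for `r ≥ ρ` has zero derivative for `r > ρ`. [folklore] -/
private theorem fderiv_eq_zero_of_lt_cylRadius_plm {ψ : EuclideanSpace ℝ (Fin 3) → ℝ} {ρ : ℝ}
    (hψ0 : ∀ x, ρ ≤ cylRadius x → ψ x = 0) {x : EuclideanSpace ℝ (Fin 3)} (hx : ρ < cylRadius x) :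
    fderiv ℝ ψ x = 0 := by
  have hopen : IsOpen {y : EuclideanSpace ℝ (Fin 3) | ρ < cylRadius y} :=
    isOpen_lt continuous_const continuous_cylRadius
  have hev : ψ =ᶠ[𝓝 x] fun _ => 0 := by
    filter_upwards [hopen.mem_nhds hx] with y hy
    exact hψ0 y (le_of_lt hy)
  rw [hev.fderiv_eq, fderiv_const_apply]

/-- Hence `‖∇ψ‖` vanishes for `r ≥ ρ + 1`. [folklore] -/
private theorem gradient_eq_zero_of_le_cylRadius_plm {ψ : EuclideanSpace ℝ (Fin 3) → ℝ} {ρ : ℝ}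
    (hψ0 : ∀ x, ρ ≤ cylRadius x → ψ x = 0) {x : EuclideanSpace ℝ (Fin 3)} (hx : ρ + 1 ≤ cylRadius x) :
    gradient ψ x = 0 := by
  rw [gradient, fderiv_eq_zero_of_lt_cylRadius_plm hψ0 (by linarith), map_zero]

/-- A nonnegative cut-off has zero gradient where it vanishes. [folklore] -/
private theorem gradient_eq_zero_of_nonneg_eq_zero_plm {ψ : EuclideanSpace ℝ (Fin 3) → ℝ}
    (hψ0 : ∀ y, 0 ≤ ψ y) {x : EuclideanSpace ℝ (Fin 3)} (hx : ψ x = 0) : gradient ψ x = 0 := by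
  have hmin : IsLocalMin ψ x := Filter.Eventually.of_forall fun y => by rw [hx]; exact hψ0 y
  rw [gradient, hmin.fderiv_eq_zero, map_zero]

/-- The closed period box `[0, L] × {r ≤ ρ}` is compact. [folklore] -/
private theorem isCompact_box_plm (L ρ : ℝ) :
    IsCompact {x : EuclideanSpace ℝ (Fin 3) | x 2 ∈ Icc 0 L ∧ cylRadius x ≤ ρ} := by
  have hx2 : Continuous fun x : EuclideanSpace ℝ (Fin 3) => x 2 :=
    (EuclideanSpace.proj (𝕜 := ℝ) (2 : Fin 3)).continuous
  refine Metric.isCompact_of_isClosed_isBounded ?_ ?_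
  · exact (isClosed_Icc.preimage hx2).inter (isClosed_le continuous_cylRadius continuous_const)
  · refine (Metric.isBounded_closedBall (x := (0 : EuclideanSpace ℝ (Fin 3))) (r := ρ + |L|)).subset
      fun x hx => ?_
    rw [mem_closedBall_zero_iff]
    have h := norm_le_cylRadius_add_abs_apply_two x
    have h2 : |x 2| ≤ |L| := by
      rw [abs_le]
      exact ⟨by linarith [hx.1.1, abs_nonneg L], hx.1.2.trans (le_abs_self L)⟩
    linarith [hx.2]

/-! ### The viscous cut-off term per period, general weight -/

/-- **The viscous cut-off term per period, general weight** (the periodic twin of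
`LeiZhang2011.abs_integral_deriv_comp_inner_gradient_le_weight`; for (3.13) of Lei–Ren–Zhang,
"`∫√Φ Δψ²`" after one integration by parts): for `F ∈ C¹`, `H ∈ C¹` with `H ≥ 0` and a
continuous weight `G_w ≥ 0` with `H'² ≤ κ H G_w` (`κ ≥ 0`), a cut-off `ψ ∈ C¹` vanishing for
`r ≥ ρ`, and `ε > 0`,
`|∫_{slab} H'(F)⟪∇F, ∇ψ²⟫| ≤ ε∫_{slab} G_w(F)‖∇F‖²ψ² + (κ/ε)∫_{slab} H(F)‖∇ψ‖²`. [cite: LeiRenZhang2019, §3, proof of Lemma 3.3, (3.13) (arXiv p. 8), the term ∫√Φ Δψ²] -/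
theorem abs_viscous_cutoff_term_le_weight_periodic {F ψ : EuclideanSpace ℝ (Fin 3) → ℝ} {ρ ε : ℝ}
    (hF : ContDiff ℝ 1 F) {H Gw : ℝ → ℝ} (hH : ContDiff ℝ 1 H) (hH0 : ∀ v, 0 ≤ H v)
    (hGwc : Continuous Gw) (hGw0 : ∀ v, 0 ≤ Gw v) {κ : ℝ} (hκ0 : 0 ≤ κ)
    (hκ : ∀ v, deriv H v ^ 2 ≤ κ * H v * Gw v)
    (hψ : ContDiff ℝ 1 ψ) (hψ0 : ∀ x, ρ ≤ cylRadius x → ψ x = 0) (hε : 0 < ε) (P : ℝ) :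
    |∫ x in zSlab P 0, deriv H (F x) * ⟪gradient F x, gradient (fun y => ψ y ^ 2) x⟫| ≤
      ε * (∫ x in zSlab P 0, Gw (F x) * ‖gradient F x‖ ^ 2 * ψ x ^ 2) +
        κ / ε * ∫ x in zSlab P 0, H (F x) * ‖gradient ψ x‖ ^ 2 := by
  have hH' : Continuous (deriv H) := hH.continuous_deriv le_rfl
  have hgrad2 : ∀ x, gradient (fun y => ψ y ^ 2) x = (2 * ψ x) • gradient ψ x := fun x =>
    gradient_sq_plm ((hψ.differentiable one_ne_zero) x)
  have hgradF : Continuous (gradient F) := continuous_gradient_of_contDiff hF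
  have hgradψ : Continuous (gradient ψ) := continuous_gradient_of_contDiff hψ
  have hgradψ0 : ∀ x, ρ + 1 ≤ cylRadius x → gradient ψ x = 0 := fun x hx =>
    gradient_eq_zero_of_le_cylRadius_plm hψ0 hx
  -- pointwise Young with the weight
  have hpt : ∀ x, |deriv H (F x) * ⟪gradient F x, gradient (fun y => ψ y ^ 2) x⟫| ≤
      ε * (Gw (F x) * ‖gradient F x‖ ^ 2 * ψ x ^ 2) + κ / ε * (H (F x) * ‖gradient ψ x‖ ^ 2) := by
    intro x
    rw [hgrad2 x, inner_smul_right, abs_mul, abs_mul]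
    have hCS : |⟪gradient F x, gradient ψ x⟫| ≤ ‖gradient F x‖ * ‖gradient ψ x‖ :=
      abs_real_inner_le_norm _ _
    have hY := two_mul_abs_mul_mul_le (‖gradient F x‖ * |ψ x|) ‖gradient ψ x‖ hε hκ0
      (hH0 (F x)) (hGw0 (F x)) (hκ (F x))
    calc |deriv H (F x)| * (|2 * ψ x| * |⟪gradient F x, gradient ψ x⟫|)
        ≤ |deriv H (F x)| * (|2 * ψ x| * (‖gradient F x‖ * ‖gradient ψ x‖)) := by
          gcongr
      _ = 2 * |deriv H (F x)| * (‖gradient F x‖ * |ψ x|) * ‖gradient ψ x‖ := by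
          rw [abs_mul, abs_two]; ring
      _ ≤ ε * Gw (F x) * (‖gradient F x‖ * |ψ x|) ^ 2 +
            κ / ε * H (F x) * ‖gradient ψ x‖ ^ 2 := hY
      _ = _ := by rw [mul_pow, sq_abs]; ring
  -- integrability on the slab
  have hcL : Continuous fun x => deriv H (F x) * ⟪gradient F x, gradient (fun y => ψ y ^ 2) x⟫ :=
    (hH'.comp hF.continuous).mul (hgradF.inner (continuous_gradient_of_contDiff (hψ.pow 2)))
  have hL0 : ∀ x, ρ + 1 ≤ cylRadius x → deriv H (F x) * ⟪gradient F x, gradient (fun y => ψ y ^ 2) x⟫ = 0 :=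
    fun x hx => by rw [hgrad2 x, hgradψ0 x hx, smul_zero, inner_zero_right, mul_zero]
  have hiR₁ : IntegrableOn (fun x => Gw (F x) * ‖gradient F x‖ ^ 2 * ψ x ^ 2) (zSlab P 0) volume :=
    integrableOn_zSlab_of_eq_zero_of_le_cylRadius
      (((hGwc.comp hF.continuous).mul (hgradF.norm.pow 2)).mul (hψ.continuous.pow 2)) (ρ := ρ)
      (fun x hx => by simp [hψ0 x hx]) P 0
  have hiR₂ : IntegrableOn (fun x => H (F x) * ‖gradient ψ x‖ ^ 2) (zSlab P 0) volume :=
    integrableOn_zSlab_of_eq_zero_of_le_cylRadius ((hH.continuous.comp hF.continuous).mul (hgradψ.norm.pow 2))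
      (ρ := ρ + 1) (fun x hx => by simp [hgradψ0 x hx]) P 0
  calc |∫ x in zSlab P 0, deriv H (F x) * ⟪gradient F x, gradient (fun y => ψ y ^ 2) x⟫|
      ≤ ∫ x in zSlab P 0, |deriv H (F x) * ⟪gradient F x, gradient (fun y => ψ y ^ 2) x⟫| :=
        abs_integral_le_integral_abs
    _ ≤ ∫ x in zSlab P 0, (ε * (Gw (F x) * ‖gradient F x‖ ^ 2 * ψ x ^ 2) +
          κ / ε * (H (F x) * ‖gradient ψ x‖ ^ 2)) :=
        integral_mono_of_nonneg (ae_of_all _ fun x => abs_nonneg _) ((hiR₁.const_mul ε).add (hiR₂.const_mul _))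
          (ae_of_all _ hpt)
    _ = _ := by
        rw [integral_add (hiR₁.const_mul ε) (hiR₂.const_mul _), MeasureTheory.integral_const_mul,
          MeasureTheory.integral_const_mul]

/-! ### The drift term per period, general weight -/

set_option maxHeartbeats 800000 in
/-- **The drift term per period, general weight** (Lei–Ren–Zhang 2019, (3.15):
"`∫ b·∇√Φ ψ² = −∫ v_r √Φ ∂ᵣψ² = ∫ (L_θ − L_θ(r,0,t)) ∂_z√Φ ∂ᵣψ² ≤ ∫|∇Φ^{1/4}|²ψ² + C∫√Φ(∂ᵣψ)²`",
in the tree's `H`-calculus). For `F ∈ C²` periodic, a `C¹` periodic drift `b` with angular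
stream potential `Φ ∈ C¹` (periodic, `∂_zΦ = ⟪b, x_h⟫`, `|Φ| ≤ C_Φ r`), `H ∈ C²` with `H ≥ 0`, a
continuous weight `G_w ≥ 0` with `H'² ≤ κ H G_w` (`κ ≥ 0`), a `z`-independent cut-off `ψ ∈ C²`
vanishing for `r ≥ ρ` with `∇ψ = a x_h`, and `ε > 0`:
`|∫_{slab} H(F)⟪b, ∇ψ²⟫| ≤ ε ∫_{slab} G_w(F)‖∇F‖²ψ² + (κ C_Φ²/ε) ∫_{slab} H(F)‖∇ψ‖²`
(integration by parts in `z` over one period through the window device, then the weighted Young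
inequality `2|H'|AW ≤ εG_wA² + (κ/ε)HW²`). [cite: LeiRenZhang2019, §3, proof of Lemma 3.3, (3.15) (arXiv p. 8)] -/
theorem abs_drift_term_le_weight_periodic {P ρ ε : ℝ} {F ψ a : EuclideanSpace ℝ (Fin 3) → ℝ}
    (hP : 0 < P) (hF : ContDiff ℝ 2 F) (hFp : IsAxiallyPeriodic P F)
    {b : EuclideanSpace ℝ (Fin 3) → EuclideanSpace ℝ (Fin 3)} (hb1 : ContDiff ℝ 1 b)
    (hbp : IsAxiallyPeriodic P b)
    {Φ : EuclideanSpace ℝ (Fin 3) → ℝ} (hΦ1 : ContDiff ℝ 1 Φ) (hΦp : IsAxiallyPeriodic P Φ)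
    (hΦz : ∀ x, fderiv ℝ Φ x eZ = ⟪b x, horizPart x⟫) {CΦ : ℝ} (hCΦ : 0 ≤ CΦ)
    (hΦb : ∀ x, |Φ x| ≤ CΦ * cylRadius x)
    {H Gw : ℝ → ℝ} (hH : ContDiff ℝ 2 H) (hH0 : ∀ v, 0 ≤ H v)
    (hGwc : Continuous Gw) (hGw0 : ∀ v, 0 ≤ Gw v) {κ : ℝ} (hκ0 : 0 ≤ κ)
    (hκ : ∀ v, deriv H v ^ 2 ≤ κ * H v * Gw v)
    (hψ : ContDiff ℝ 2 ψ) (hψz : ∀ (x : EuclideanSpace ℝ (Fin 3)) (t : ℝ), ψ (x + t • eZ) = ψ x)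
    (hψ0 : ∀ x, ρ ≤ cylRadius x → ψ x = 0)
    (ha : ContDiff ℝ 1 a) (haz : ∀ (x : EuclideanSpace ℝ (Fin 3)) (t : ℝ), a (x + t • eZ) = a x)
    (hψg : ∀ x, gradient ψ x = a x • horizPart x) (hε : 0 < ε) :
    |∫ x in zSlab P 0, H (F x) * ⟪b x, gradient (fun y => ψ y ^ 2) x⟫| ≤
      ε * (∫ x in zSlab P 0, Gw (F x) * ‖gradient F x‖ ^ 2 * ψ x ^ 2) +
        κ * CΦ ^ 2 / ε * ∫ x in zSlab P 0, H (F x) * ‖gradient ψ x‖ ^ 2 := by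
  rw [← drift_window_eq hP hF hFp hb1.continuous hbp hH hψ hψz hψ0]
  have hψ' : ContDiff ℝ 1 ψ := hψ.of_le one_le_two
  have hF1 : ContDiff ℝ 1 F := hF.of_le one_le_two
  have hH1 : ContDiff ℝ 1 H := hH.of_le one_le_two
  have hψp : IsAxiallyPeriodic P ψ := periodic_of_forall_add_smul_plm hψz
  have hap : IsAxiallyPeriodic P a := periodic_of_forall_add_smul_plm haz
  set ω2 : ℝ → ℝ := fun z => periodicWindow P z ^ 2 with hω2
  have hW2 : ∀ z, ω2 z ≠ 0 → |z| ≤ 2 * P := fun z hz => abs_le_of_periodicWindow_sq_ne_zero_plm hP z hz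
  have hW2C : ContDiff ℝ 1 ω2 := contDiff_periodicWindow_sq P (n := 1)
  have hW2c : Continuous ω2 := hW2C.continuous
  have hW2' : Continuous (deriv ω2) := hW2C.continuous_deriv le_rfl
  have hW2'cs : HasCompactSupport (deriv ω2) := (hasCompactSupport_periodicWindow_sq hP).deriv
  obtain ⟨A, hA⟩ : ∃ A : ℝ, ∀ z, deriv ω2 z ≠ 0 → |z| ≤ A := by
    obtain ⟨A, hA⟩ := (hW2'cs.isCompact.isBounded).subset_closedBall 0
    exact ⟨A, fun z hz => by
      have := hA (subset_tsupport _ (mem_support.2 hz))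
      rwa [mem_closedBall_zero_iff, Real.norm_eq_abs] at this⟩
  have hx2c : Continuous fun x : EuclideanSpace ℝ (Fin 3) => x 2 :=
    (EuclideanSpace.proj (𝕜 := ℝ) (2 : Fin 3)).continuous
  -- `⟪b, ∇φ̃²⟫ = 2ψ a ∂_zΦ ω² + ψ² b_z (ω²)'`
  have hgrad2 : ∀ x, gradient (fun y => ψ y ^ 2) x = (2 * ψ x) • gradient ψ x := fun x =>
    gradient_sq_plm ((hψ'.differentiable one_ne_zero) x)
  -- the `C¹` coefficient `c = 2ψa`
  set c : EuclideanSpace ℝ (Fin 3) → ℝ := fun x => 2 * ψ x * a x with hc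
  have hc1 : ContDiff ℝ 1 c := (contDiff_const.mul hψ').mul ha
  have hcz : ∀ (x : EuclideanSpace ℝ (Fin 3)) (t : ℝ), c (x + t • eZ) = c x := fun x t => by
    simp only [hc, hψz, haz]
  have hsplit : ∀ x, H (F x) * ⟪b x, gradient (fun y => (ψ y * periodicWindow P (y 2)) ^ 2) x⟫ =
      fderiv ℝ Φ x eZ * (c x * H (F x) * ω2 (x 2)) +
        (H (F x) * ψ x ^ 2 * (b x) 2) * deriv ω2 (x 2) := by
    intro x
    rw [gradient_windowCutoff_sq P hψ' x, inner_add_right, real_inner_smul_right, real_inner_smul_right,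
      hgrad2 x, real_inner_smul_right, hψg x, real_inner_smul_right, ← hΦz x]
    have : ⟪b x, (eZ : EuclideanSpace ℝ (Fin 3))⟫ = (b x) 2 := by
      simp [PiLp.inner_apply, eZ]
    rw [this]
    simp only [hc, hω2]
    ring
  -- the `(ω²)'`-junk term vanishes
  set Q₂ : EuclideanSpace ℝ (Fin 3) → ℝ := fun x => H (F x) * ψ x ^ 2 * (b x) 2 with hQ₂
  have hb2c : Continuous fun x => (b x) 2 := (EuclideanSpace.proj (𝕜 := ℝ) (2 : Fin 3)).continuous.comp hb1.continuous
  have hHFc : Continuous fun x => H (F x) := hH.continuous.comp hF.continuous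
  have hQ₂c : Continuous Q₂ := (hHFc.mul (hψ.continuous.pow 2)).mul hb2c
  have hQ₂0 : ∀ x, ρ ≤ cylRadius x → Q₂ x = 0 := fun x hx => by simp only [hQ₂, hψ0 x hx]; ring
  have hQ₂p : IsAxiallyPeriodic P Q₂ := periodic_of_eZ_plm fun x => by
    simp only [hQ₂, periodic_apply_plm hFp, periodic_apply_plm hψp, periodic_apply_plm hbp]
  obtain ⟨-, hQ₂zero⟩ := integral_mul_window_sq_eq_and_deriv_eq_zero hP hQ₂c hQ₂p hQ₂0
  -- the main term: integrate by parts in `z`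
  set Θ : EuclideanSpace ℝ (Fin 3) → ℝ := fun x => c x * H (F x) * ω2 (x 2) with hΘ
  have hcH1 : ContDiff ℝ 1 fun x => c x * H (F x) := hc1.mul (hH1.comp hF1)
  have hΘ1 : ContDiff ℝ 1 Θ := contDiff_mul_comp_apply_two hcH1 hW2C
  have hc0 : ∀ x, ρ ≤ cylRadius x → c x = 0 := fun x hx => by simp only [hc, hψ0 x hx]; ring
  have hcH0 : ∀ x, ρ ≤ cylRadius x → c x * H (F x) = 0 := fun x hx => by rw [hc0 x hx, zero_mul]
  have hΘc : HasCompactSupport Θ := hasCompactSupport_mul_comp_apply_two (W := ω2) hcH0 hW2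
  -- `∂_z Θ = c H'(F) ∂_zF ω² + c H(F) (ω²)'`
  have hΘz : ∀ x, fderiv ℝ Θ x eZ =
      c x * (deriv H (F x) * fderiv ℝ F x eZ) * ω2 (x 2) + c x * H (F x) * deriv ω2 (x 2) := by
    intro x
    have hcd : DifferentiableAt ℝ c x := (hc1.differentiable one_ne_zero) x
    have hHFd : DifferentiableAt ℝ (fun y => H (F y)) x := ((hH1.comp hF1).differentiable one_ne_zero) x
    have hcHd : DifferentiableAt ℝ (fun y => c y * H (F y)) x := hcd.mul hHFd
    have hW2d : DifferentiableAt ℝ ω2 (x 2) := (hW2C.differentiable one_ne_zero) _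
    rw [show Θ = fun y => (fun y => c y * H (F y)) y * ω2 (y 2) from rfl,
      fderiv_mul_comp_apply_two hcHd hW2d, fderiv_fun_mul hcd hHFd]
    have hcz0 : fderiv ℝ c x eZ = 0 := fderiv_eZ_eq_zero_of_forall_add_smul_plm hcd (hcz x)
    have hd : fderiv ℝ (fun y => H (F y)) x = deriv H (F x) • fderiv ℝ F x :=
      ((((hH.differentiable two_ne_zero) (F x)).hasDerivAt).comp_hasFDerivAt x
        ((hF.differentiable two_ne_zero) x).hasFDerivAt).fderiv
    simp only [_root_.add_apply, FunLike.coe_smul, Pi.smul_apply, smul_eq_mul, hd, hcz0, mul_zero,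
      add_zero]
    simp only [eZ, PiLp.single_apply, if_true, mul_one]
    ring
  -- `∫ ∂_z(ΦΘ) = 0`
  have hprod1 : ContDiff ℝ 1 fun x => Φ x * Θ x := hΦ1.mul hΘ1
  have hprodc : HasCompactSupport fun x => Φ x * Θ x := hΘc.mul_left
  have hIBP := integral_fderiv_apply_eq_zero hprod1 hprodc eZ
  have hprodz : ∀ x, fderiv ℝ (fun y => Φ y * Θ y) x eZ =
      fderiv ℝ Φ x eZ * Θ x + Φ x * fderiv ℝ Θ x eZ := by
    intro x
    rw [fderiv_fun_mul ((hΦ1.differentiable one_ne_zero) x) ((hΘ1.differentiable one_ne_zero) x)]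
    simp only [_root_.add_apply, FunLike.coe_smul, Pi.smul_apply, smul_eq_mul]
    ring
  simp_rw [hprodz] at hIBP
  -- integrability of the two products
  have hΘcont : Continuous Θ := hΘ1.continuous
  have hΘzc : Continuous fun x => fderiv ℝ Θ x eZ := (hΘ1.continuous_fderiv one_ne_zero).clm_apply continuous_const
  have hΦzc : Continuous fun x => fderiv ℝ Φ x eZ := (hΦ1.continuous_fderiv one_ne_zero).clm_apply continuous_const
  have hΘzcs : HasCompactSupport fun x => fderiv ℝ Θ x eZ := hΘc.fderiv_apply (𝕜 := ℝ) eZ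
  have hiA : Integrable (fun x => fderiv ℝ Φ x eZ * Θ x) (volume : Measure (EuclideanSpace ℝ (Fin 3))) :=
    (hΦzc.mul hΘcont).integrable_of_hasCompactSupport hΘc.mul_left
  have hiB : Integrable (fun x => Φ x * fderiv ℝ Θ x eZ) (volume : Measure (EuclideanSpace ℝ (Fin 3))) :=
    (hΦ1.continuous.mul hΘzc).integrable_of_hasCompactSupport hΘzcs.mul_left
  rw [integral_add hiA hiB] at hIBP
  -- the second junk term `∫ Φ c H(F) (ω²)' = 0`
  set Q₃ : EuclideanSpace ℝ (Fin 3) → ℝ := fun x => Φ x * (c x * H (F x)) with hQ₃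
  have hQ₃c : Continuous Q₃ := hΦ1.continuous.mul hcH1.continuous
  have hQ₃0 : ∀ x, ρ ≤ cylRadius x → Q₃ x = 0 := fun x hx => by simp only [hQ₃, hcH0 x hx, mul_zero]
  have hcp : IsAxiallyPeriodic P c := periodic_of_forall_add_smul_plm hcz
  have hQ₃p : IsAxiallyPeriodic P Q₃ := periodic_of_eZ_plm fun x => by
    simp only [hQ₃, periodic_apply_plm hΦp, periodic_apply_plm hcp, periodic_apply_plm hFp]
  obtain ⟨-, hQ₃zero⟩ := integral_mul_window_sq_eq_and_deriv_eq_zero hP hQ₃c hQ₃p hQ₃0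
  -- the main term after integration by parts
  set Mn : EuclideanSpace ℝ (Fin 3) → ℝ := fun x =>
    Φ x * (c x * (deriv H (F x) * fderiv ℝ F x eZ)) * ω2 (x 2) with hMn
  have hHFc' : Continuous fun x => deriv H (F x) := (hH.continuous_deriv (by norm_num)).comp hF.continuous
  have hFz : Continuous fun x => fderiv ℝ F x eZ := (hF.continuous_fderiv (by norm_num)).clm_apply continuous_const
  have hMn0 : ∀ x, ρ ≤ cylRadius x → Φ x * (c x * (deriv H (F x) * fderiv ℝ F x eZ)) = 0 := fun x hx => by
    rw [hc0 x hx]; ring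
  have hiMn : Integrable Mn (volume : Measure (EuclideanSpace ℝ (Fin 3))) :=
    ((hΦ1.continuous.mul (hc1.continuous.mul (hHFc'.mul hFz))).mul (hW2c.comp hx2c)).integrable_of_hasCompactSupport
      (hasCompactSupport_mul_comp_apply_two (W := ω2) hMn0 hW2)
  have hiQ₃ : Integrable (fun x => Q₃ x * deriv ω2 (x 2)) (volume : Measure (EuclideanSpace ℝ (Fin 3))) :=
    (hQ₃c.mul (hW2'.comp hx2c)).integrable_of_hasCompactSupport
      (hasCompactSupport_mul_comp_apply_two (W := deriv ω2) hQ₃0 hA)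
  have hBsplit : ∫ x, Φ x * fderiv ℝ Θ x eZ = (∫ x, Mn x) + ∫ x, Q₃ x * deriv ω2 (x 2) := by
    rw [← integral_add hiMn hiQ₃]
    refine integral_congr_ae (Eventually.of_forall fun x => ?_)
    simp only [hΘz x, hMn, hQ₃]
    ring
  rw [hBsplit, hQ₃zero, add_zero] at hIBP
  -- so `∫ ∂_zΦ Θ = −∫ Mn`
  have hmain : ∫ x, fderiv ℝ Φ x eZ * Θ x = -∫ x, Mn x := by linarith
  -- assemble the left-hand side
  have hi2 : Integrable (fun x => Q₂ x * deriv ω2 (x 2)) (volume : Measure (EuclideanSpace ℝ (Fin 3))) :=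
    (hQ₂c.mul (hW2'.comp hx2c)).integrable_of_hasCompactSupport
      (hasCompactSupport_mul_comp_apply_two (W := deriv ω2) hQ₂0 hA)
  have hLHS : ∫ x, H (F x) * ⟪b x, gradient (fun y => (ψ y * periodicWindow P (y 2)) ^ 2) x⟫ =
      -∫ x, Mn x := by
    simp_rw [hsplit]
    rw [integral_add hiA hi2, hQ₂zero, add_zero, hmain]
  rw [hLHS]
  -- pointwise weighted Young on `Mn`: `|Mn| ≤ (ε G_w(F)‖∇F‖²ψ² + (κC_Φ²/ε) H(F)‖∇ψ‖²) ω²`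
  have hpt : ∀ x, |Mn x| ≤
      ε * (Gw (F x) * ‖gradient F x‖ ^ 2 * ψ x ^ 2 * ω2 (x 2)) +
        κ * CΦ ^ 2 / ε * (H (F x) * ‖gradient ψ x‖ ^ 2 * ω2 (x 2)) := by
    intro x
    have hw0 : 0 ≤ ω2 (x 2) := sq_nonneg _
    have hΦc : |Φ x * c x| ≤ 2 * |ψ x| * (CΦ * ‖gradient ψ x‖) := by
      rw [hψg x, norm_smul_horizPart, abs_mul]
      simp only [hc, abs_mul, abs_two]
      have h1 := hΦb x
      have h2 : 0 ≤ |a x| := abs_nonneg _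
      have h3 : 0 ≤ |ψ x| := abs_nonneg _
      calc |Φ x| * (2 * |ψ x| * |a x|) ≤ CΦ * cylRadius x * (2 * |ψ x| * |a x|) := by gcongr
        _ = 2 * |ψ x| * (CΦ * (|a x| * cylRadius x)) := by ring
        _ ≤ 2 * |ψ x| * (CΦ * (|a x| * cylRadius x)) := le_rfl
    have hFz' : |fderiv ℝ F x eZ| ≤ ‖gradient F x‖ := abs_fderiv_eZ_le_norm_gradient_plm F x
    have hMn_abs : |Mn x| = |Φ x * c x| * |deriv H (F x)| * |fderiv ℝ F x eZ| * ω2 (x 2) := by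
      simp only [hMn, abs_mul, abs_of_nonneg hw0]
      ring
    rw [hMn_abs]
    have hstep : |Φ x * c x| * |deriv H (F x)| * |fderiv ℝ F x eZ| ≤
        2 * |deriv H (F x)| * (‖gradient F x‖ * |ψ x|) * (CΦ * ‖gradient ψ x‖) := by
      have h4 : 0 ≤ |deriv H (F x)| := abs_nonneg _
      calc |Φ x * c x| * |deriv H (F x)| * |fderiv ℝ F x eZ|
          ≤ (2 * |ψ x| * (CΦ * ‖gradient ψ x‖)) * |deriv H (F x)| * ‖gradient F x‖ := by
            gcongr
        _ = 2 * |deriv H (F x)| * (‖gradient F x‖ * |ψ x|) * (CΦ * ‖gradient ψ x‖) := by ring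
    have hY := two_mul_abs_mul_mul_le (‖gradient F x‖ * |ψ x|) (CΦ * ‖gradient ψ x‖) hε hκ0
      (hH0 (F x)) (hGw0 (F x)) (hκ (F x))
    calc |Φ x * c x| * |deriv H (F x)| * |fderiv ℝ F x eZ| * ω2 (x 2)
        ≤ (2 * |deriv H (F x)| * (‖gradient F x‖ * |ψ x|) * (CΦ * ‖gradient ψ x‖)) * ω2 (x 2) :=
          mul_le_mul_of_nonneg_right hstep hw0
      _ ≤ (ε * Gw (F x) * (‖gradient F x‖ * |ψ x|) ^ 2 +
            κ / ε * H (F x) * (CΦ * ‖gradient ψ x‖) ^ 2) * ω2 (x 2) :=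
          mul_le_mul_of_nonneg_right hY hw0
      _ = _ := by rw [mul_pow, mul_pow, sq_abs, div_eq_mul_inv, div_eq_mul_inv]; ring
  -- the right-hand sides as window integrals, then as slab integrals
  set R₁ : EuclideanSpace ℝ (Fin 3) → ℝ := fun x =>
    Gw (F x) * ‖gradient F x‖ ^ 2 * ψ x ^ 2 with hR₁
  set R₂ : EuclideanSpace ℝ (Fin 3) → ℝ := fun x => H (F x) * ‖gradient ψ x‖ ^ 2 with hR₂
  have hgradF : Continuous (gradient F) := continuous_gradient_of_contDiff hF1
  have hR₁c : Continuous R₁ := (((hGwc.comp hF.continuous)).mul (hgradF.norm.pow 2)).mul (hψ.continuous.pow 2)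
  have hgradψ : Continuous (gradient ψ) := continuous_gradient_of_contDiff hψ'
  have hR₂c : Continuous R₂ := hHFc.mul (hgradψ.norm.pow 2)
  have hR₁0 : ∀ x, ρ ≤ cylRadius x → R₁ x = 0 := fun x hx => by simp only [hR₁, hψ0 x hx]; ring
  have hR₂0 : ∀ x, ρ + 1 ≤ cylRadius x → R₂ x = 0 := fun x hx => by
    simp only [hR₂, gradient_eq_zero_of_le_cylRadius_plm hψ0 hx, norm_zero]; ring
  have hg1 : IsAxiallyPeriodic P (gradient F) := periodic_of_eZ_plm fun x => by
    simp only [gradient, periodic_apply_plm (periodic_fderiv_plm hFp)]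
  have hgψ : IsAxiallyPeriodic P (gradient ψ) := periodic_of_eZ_plm fun x => by
    simp only [gradient, periodic_apply_plm (periodic_fderiv_plm hψp)]
  have hR₁p : IsAxiallyPeriodic P R₁ := periodic_of_eZ_plm fun x => by
    simp only [hR₁, periodic_apply_plm hFp, periodic_apply_plm hg1, periodic_apply_plm hψp]
  have hR₂p : IsAxiallyPeriodic P R₂ := periodic_of_eZ_plm fun x => by
    simp only [hR₂, periodic_apply_plm hFp, periodic_apply_plm hgψ]
  obtain ⟨hR₁w, -⟩ := integral_mul_window_sq_eq_and_deriv_eq_zero hP hR₁c hR₁p hR₁0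
  obtain ⟨hR₂w, -⟩ := integral_mul_window_sq_eq_and_deriv_eq_zero hP hR₂c hR₂p hR₂0
  have hiR₁ : Integrable (fun x => R₁ x * periodicWindow P (x 2) ^ 2)
      (volume : Measure (EuclideanSpace ℝ (Fin 3))) :=
    (hR₁c.mul (hW2c.comp hx2c)).integrable_of_hasCompactSupport
      (hasCompactSupport_mul_comp_apply_two (W := ω2) hR₁0 hW2)
  have hiR₂ : Integrable (fun x => R₂ x * periodicWindow P (x 2) ^ 2)
      (volume : Measure (EuclideanSpace ℝ (Fin 3))) :=
    (hR₂c.mul (hW2c.comp hx2c)).integrable_of_hasCompactSupport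
      (hasCompactSupport_mul_comp_apply_two (W := ω2) hR₂0 hW2)
  rw [← hR₁w, ← hR₂w]
  calc |-∫ x, Mn x| = |∫ x, Mn x| := abs_neg _
    _ ≤ ∫ x, |Mn x| := abs_integral_le_integral_abs
    _ ≤ ∫ x, (ε * (R₁ x * periodicWindow P (x 2) ^ 2) + κ * CΦ ^ 2 / ε * (R₂ x * periodicWindow P (x 2) ^ 2)) := by
        refine integral_mono_of_nonneg (Eventually.of_forall fun x => abs_nonneg _)
          ((hiR₁.const_mul ε).add (hiR₂.const_mul (κ * CΦ ^ 2 / ε))) (Eventually.of_forall fun x => ?_)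
        have h := hpt x
        simp only [hR₁, hR₂, hω2] at h ⊢
        refine h.trans (le_of_eq ?_)
        ring
    _ = ε * (∫ x, R₁ x * periodicWindow P (x 2) ^ 2) +
          κ * CΦ ^ 2 / ε * ∫ x, R₂ x * periodicWindow P (x 2) ^ 2 := by
        rw [integral_add (hiR₁.const_mul ε) (hiR₂.const_mul (κ * CΦ ^ 2 / ε)),
          MeasureTheory.integral_const_mul, MeasureTheory.integral_const_mul]


/-! ### Integrability of the tested slice -/

/-- The tested slice `H'(F) N (ψ ω(x₂))²` is integrable on `ℝ³` (`N = ΔF − DF[b] − (2/r)∂ᵣF`,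
`F ∈ C²` axisymmetric, `b ∈ C¹`, `H ∈ C²`, `ψ ∈ C²` axisymmetric vanishing for `r ≥ ρ`): the
three pieces are continuous with compact support, the axis piece by
`integral_axis_term_eq_sub_boundary`. [cite: LeiRenZhang2019, §2 (2.4) and §3 (3.13) (arXiv pp. 5, 8: testing the equation with the cut-off)] -/
theorem integrable_testedSlice_periodic {P ρ : ℝ} (hP : 0 < P)
    {F N : EuclideanSpace ℝ (Fin 3) → ℝ} {b : EuclideanSpace ℝ (Fin 3) → EuclideanSpace ℝ (Fin 3)}
    {H : ℝ → ℝ} {ψ : EuclideanSpace ℝ (Fin 3) → ℝ}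
    (hF2 : ContDiff ℝ 2 F) (hFa : IsAxisymmetricScalar F) (hb1 : ContDiff ℝ 1 b)
    (hN : ∀ x, N x = (Δ F) x - fderiv ℝ F x (b x) - 2 / cylRadius x * fderiv ℝ F x (eR x))
    (hH : ContDiff ℝ 2 H) (hψ : ContDiff ℝ 2 ψ) (hψa : IsAxisymmetricScalar ψ)
    (hψ0 : ∀ x, ρ ≤ cylRadius x → ψ x = 0) :
    Integrable (fun x => deriv H (F x) * N x * (ψ x * periodicWindow P (x 2)) ^ 2)
      (volume : Measure (EuclideanSpace ℝ (Fin 3))) := by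
  obtain ⟨φt, hφt⟩ : ∃ φt : EuclideanSpace ℝ (Fin 3) → ℝ, φt = fun y => ψ y * periodicWindow P (y 2) :=
    ⟨_, rfl⟩
  have hφt2 : ContDiff ℝ 2 φt := by rw [hφt]; exact contDiff_mul_comp_apply_two hψ (contDiff_periodicWindow P)
  have hφt1 : ContDiff ℝ 1 φt := hφt2.of_le one_le_two
  have hφtc : HasCompactSupport φt := by
    rw [hφt]
    exact hasCompactSupport_mul_comp_apply_two hψ0 (A := 2 * P) fun z hz =>
      abs_le_of_periodicWindow_ne_zero_plm hP z hz
  have hφta : IsAxisymmetricScalar φt := by rw [hφt]; exact isAxisymmetricScalar_mul_comp_apply_two hψa _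
  have hφt2c : HasCompactSupport fun y => φt y ^ 2 := hφtc.comp_left (g := fun t : ℝ => t ^ 2) (by simp)
  have hH1 : ContDiff ℝ 1 H := hH.of_le one_le_two
  set P₁ : EuclideanSpace ℝ (Fin 3) → ℝ := fun x => deriv H (F x) * φt x ^ 2 * (Δ F) x with hP₁
  set P₂ : EuclideanSpace ℝ (Fin 3) → ℝ := fun x => ⟪b x, gradient F x⟫ * (deriv H (F x) * φt x ^ 2) with hP₂
  set P₃ : EuclideanSpace ℝ (Fin 3) → ℝ := fun x =>
    2 / cylRadius x * (fderiv ℝ F x (eR x) * (deriv H (F x) * φt x ^ 2)) with hP₃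
  have hHF : Continuous fun x => deriv H (F x) := (hH.continuous_deriv (by norm_num)).comp hF2.continuous
  have hσc : Continuous fun x => deriv H (F x) * φt x ^ 2 := hHF.mul (hφt2.continuous.pow 2)
  have hσcs : HasCompactSupport fun x => deriv H (F x) * φt x ^ 2 := hφt2c.mul_left
  have hΔc : Continuous (Δ F) := by
    have h2 : ContDiff ℝ ((0 : ℕ∞) + 2 : ℕ∞) F := by simpa using hF2
    exact (contDiff_laplacian (n := 0) h2).continuous
  have hiP₁ : Integrable P₁ (volume : Measure (EuclideanSpace ℝ (Fin 3))) :=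
    (hσc.mul hΔc).integrable_of_hasCompactSupport hσcs.mul_right
  have hgradF : Continuous (gradient F) := continuous_gradient_of_contDiff (hF2.of_le one_le_two)
  have hiP₂ : Integrable P₂ (volume : Measure (EuclideanSpace ℝ (Fin 3))) :=
    ((hb1.continuous.inner hgradF).mul hσc).integrable_of_hasCompactSupport hσcs.mul_left
  obtain ⟨hiP₃, -, -⟩ := integral_axis_term_eq_sub_boundary (hF2.of_le one_le_two) hFa hH1 hφt1 hφtc hφta
  have hpt : ∀ x, deriv H (F x) * N x * (ψ x * periodicWindow P (x 2)) ^ 2 = P₁ x - P₂ x - P₃ x := by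
    intro x
    have e : (ψ x * periodicWindow P (x 2)) ^ 2 = φt x ^ 2 := by rw [hφt]
    simp only [hP₁, hP₂, hP₃, hN x, ← inner_gradient_left F x (b x), real_inner_comm (b x), e]
    ring
  exact ((hiP₁.sub hiP₂).sub hiP₃).congr (ae_of_all _ fun x => (hpt x).symm)

/-! ### Lemma 3.3, analytic core -/

set_option maxHeartbeats 1600000 in
-- one long assembly proof (the identity, the tested slice through Fubini, the pointwise-in-time
-- bound through the weighted slab estimates, integration in time)
/-- **Lemma 3.3 of Lei–Ren–Zhang 2019, analytic core** (the periodic twin of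
`LeiZhang2011.lower_mass_core`). In the periodic swirl setting on `[−T₁, 0]` (no vanishing on the
axis: `F(s,·) ∈ C²` axisymmetric `P`-periodic, `C¹` divergence-free periodic drift `b` with
angular stream potential `Φ`, `|Φ| ≤ C_Φ r`, the time-integrated equation), for a positive
`H ∈ C²` with a continuous weight `G_w ≥ 0`, `H'² ≤ κHG_w`, `H''(F) = −G_w(F)` on
`[−T₁,0] × {r ≤ ρ}`, a `z`-independent axisymmetric cut-off `ψ ∈ C²` (`ψ = 1` on `{r ≤ ρ'}`,
`ψ = 0` on `{r ≥ ρ}`, `0 ≤ ψ ≤ 1`, `‖∇ψ‖ ≤ D`, `∇ψ = a x_h`, `|(2/r)∂ᵣψ²| ≤ C_ax ψ`), a time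
cut-off `η ∈ C¹` vanishing at both ends with `0 ≤ η ≤ 1`, `|η'| ≤ D'`, and the space–time
integrability of the tested equation: the time integral of the axis boundary term
((3.14): "`−2∭√Φ|_{r=0}ψ² dθ dz dt`") is controlled by the cut-off terms,
`∫ η(s) · 2c₂ψ(0)²∫_0^P H(F(s,0,0,z))dz ds ≤ ∫ (4κD²(1 + C_Φ²) + C_ax + D') ∫_{[0,P]×{r≤ρ}} H(F(s)) ds`
((3.13)–(3.15)). [cite: LeiRenZhang2019, §3, proof of Lemma 3.3, (3.13)–(3.15) (arXiv p. 8)] -/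
theorem lower_mass_core_periodic {P T₁ ρ ρ' : ℝ} (hP : 0 < P) (hT₁ : 0 < T₁)
    {F N : ℝ → EuclideanSpace ℝ (Fin 3) → ℝ}
    {b : ℝ → EuclideanSpace ℝ (Fin 3) → EuclideanSpace ℝ (Fin 3)}
    {Φ : ℝ → EuclideanSpace ℝ (Fin 3) → ℝ}
    (hF2 : ∀ s, ContDiff ℝ 2 (F s)) (hFa : ∀ s, IsAxisymmetricScalar (F s))
    (hFp : ∀ s, IsAxiallyPeriodic P (F s))
    (hb1 : ∀ s, ContDiff ℝ 1 (b s)) (hbdiv : ∀ s x, VectorCalculus.divergence (b s) x = 0)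
    (hbp : ∀ s, IsAxiallyPeriodic P (b s))
    (hΦ1 : ∀ s, ContDiff ℝ 1 (Φ s)) (hΦp : ∀ s, IsAxiallyPeriodic P (Φ s))
    (hΦz : ∀ s x, fderiv ℝ (Φ s) x eZ = ⟪b s x, horizPart x⟫)
    {CΦ : ℝ} (hCΦ : 0 ≤ CΦ) (hΦb : ∀ s x, |Φ s x| ≤ CΦ * cylRadius x)
    (hN : ∀ s x, N s x =
      (Δ (F s)) x - fderiv ℝ (F s) x (b s x) - 2 / cylRadius x * fderiv ℝ (F s) x (eR x))
    (heq : ∀ᵐ x ∂(volume : Measure (EuclideanSpace ℝ (Fin 3))),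
      IntervalIntegrable (fun s => N s x) volume (-T₁) 0 ∧
        ∀ s ∈ Icc (-T₁) 0, F s x = F (-T₁) x + ∫ τ in (-T₁)..s, N τ x)
    (hFc : Continuous fun p : ℝ × EuclideanSpace ℝ (Fin 3) => F p.1 p.2)
    {H Gw : ℝ → ℝ} (hH : ContDiff ℝ 2 H) (hHpos : ∀ v, 0 < H v) (hGwc : Continuous Gw)
    (hGw0 : ∀ v, 0 ≤ Gw v) {κ : ℝ} (hκ0 : 0 ≤ κ) (hκ : ∀ v, deriv H v ^ 2 ≤ κ * H v * Gw v)
    (hG : ∀ s ∈ Icc (-T₁) 0, ∀ x, cylRadius x ≤ ρ → deriv (deriv H) (F s x) = -Gw (F s x))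
    {ψ a : EuclideanSpace ℝ (Fin 3) → ℝ} (hψ : ContDiff ℝ 2 ψ) (hψa : IsAxisymmetricScalar ψ)
    (hψz : ∀ (x : EuclideanSpace ℝ (Fin 3)) (t : ℝ), ψ (x + t • eZ) = ψ x)
    (hρ' : 0 < ρ') (hψ1 : ∀ x, cylRadius x ≤ ρ' → ψ x = 1) (hψ0 : ∀ x, ρ ≤ cylRadius x → ψ x = 0)
    (hψ01 : ∀ x, 0 ≤ ψ x ∧ ψ x ≤ 1) {D : ℝ} (hψD : ∀ x, ‖gradient ψ x‖ ≤ D)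
    (ha : ContDiff ℝ 1 a) (haz : ∀ (x : EuclideanSpace ℝ (Fin 3)) (t : ℝ), a (x + t • eZ) = a x)
    (hψg : ∀ x, gradient ψ x = a x • horizPart x)
    {Cax : ℝ} (hCax : 0 ≤ Cax)
    (hψax : ∀ x, |2 / cylRadius x * fderiv ℝ (fun y => ψ y ^ 2) x (eR x)| ≤ Cax * ψ x)
    {η : ℝ → ℝ} (hη : ContDiff ℝ 1 η) (hη1 : η (-T₁) = 0) (hη2 : η 0 = 0)
    (hη01 : ∀ s, 0 ≤ η s ∧ η s ≤ 1) {D' : ℝ} (hηD : ∀ s, |deriv η s| ≤ D')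
    (hint : Integrable (fun p : ℝ × EuclideanSpace ℝ (Fin 3) =>
      (deriv H (F p.1 p.2) * N p.1 p.2 * η p.1 + H (F p.1 p.2) * deriv η p.1) *
        (ψ p.2 * periodicWindow P (p.2 2)) ^ 2) ((volume.restrict (Ioc (-T₁) 0)).prod volume)) :
    ∫ s in (-T₁)..0, η s * (2 * radialConst₂ * (ψ 0 ^ 2 * ∫ z in (0 : ℝ)..P, H (F s (meridianPoint (0, z))))) ≤
      ∫ s in (-T₁)..0, (4 * κ * D ^ 2 * (1 + CΦ ^ 2) + Cax + D') *
        ∫ x in {x : EuclideanSpace ℝ (Fin 3) | x 2 ∈ Icc 0 P ∧ cylRadius x ≤ ρ}, H (F s x) := by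
  have ht₁ : -T₁ ≤ (0 : ℝ) := by linarith
  have hH0 : ∀ v, 0 ≤ H v := fun v => (hHpos v).le
  have hH1 : ContDiff ℝ 1 H := hH.of_le one_le_two
  have hψ' : ContDiff ℝ 1 ψ := hψ.of_le one_le_two
  have hD0 : 0 ≤ D := (norm_nonneg _).trans (hψD 0)
  have hD'0 : 0 ≤ D' := (abs_nonneg _).trans (hηD 0)
  set K : Set (EuclideanSpace ℝ (Fin 3)) := {x | x 2 ∈ Icc 0 P ∧ cylRadius x ≤ ρ} with hK
  have hKc : IsCompact K := isCompact_box_plm P ρ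
  have hKm : MeasurableSet K := hKc.isClosed.measurableSet
  have hgradψ0 : ∀ x, ρ ≤ cylRadius x → gradient ψ x = 0 := fun x hx =>
    gradient_eq_zero_of_nonneg_eq_zero_plm (fun y => (hψ01 y).1) (hψ0 x hx)
  have hHFs : ∀ s, Continuous fun x => H (F s x) := fun s => hH.continuous.comp (hF2 s).continuous
  have hHFc : Continuous fun p : ℝ × EuclideanSpace ℝ (Fin 3) => H (F p.1 p.2) := hH.continuous.comp hFc
  have hH'c : Continuous (deriv H) := hH.continuous_deriv (by norm_num)
  have hH''c : Continuous (deriv (deriv H)) := by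
    have h2 : ContDiff ℝ (1 + 1) H := by rw [one_add_one_eq_two]; exact hH
    exact h2.deriv'.continuous_deriv le_rfl
  have hgradψ2 : Continuous (gradient fun y => ψ y ^ 2) := continuous_gradient_of_contDiff (hψ'.pow 2)
  have hgrad2 : ∀ x, gradient (fun y => ψ y ^ 2) x = (2 * ψ x) • gradient ψ x := fun x =>
    gradient_sq_plm ((hψ'.differentiable one_ne_zero) x)
  have hgradψ2_0 : ∀ x, ρ ≤ cylRadius x → gradient (fun y => ψ y ^ 2) x = 0 := fun x hx => by
    rw [hgrad2 x, hgradψ0 x hx, smul_zero]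
  have hx2c : Continuous fun x : EuclideanSpace ℝ (Fin 3) => x 2 :=
    (EuclideanSpace.proj (𝕜 := ℝ) (2 : Fin 3)).continuous
  -- ### Step 1: the identity, whose left-hand side vanishes
  have hid := energy_identity_axis_periodic ht₁ hP hF2 hFa hFp hb1 hbdiv hbp hN heq hH hψ hψa hψz hρ'
    hψ1 hψ0 ha.continuous haz hψg hη hint
  have hLHS : ∫ x in zSlab P 0, (H (F 0 x) * η 0 - H (F (-T₁) x) * η (-T₁)) * ψ x ^ 2 = 0 := by
    simp [hη1, hη2]
  rw [hLHS] at hid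
  obtain ⟨I, hI⟩ : ∃ I : ℝ → ℝ, ∀ s, I s = η s *
        (-(∫ x in zSlab P 0, (deriv (deriv H) (F s x) * ‖gradient (F s) x‖ ^ 2 * ψ x ^ 2 +
            deriv H (F s x) * ⟪gradient (F s) x, gradient (fun y => ψ y ^ 2) x⟫)) +
          (∫ x in zSlab P 0, H (F s x) * ⟪b s x, gradient (fun y => ψ y ^ 2) x⟫) +
          ((∫ x in zSlab P 0, 2 / cylRadius x * (H (F s x) * fderiv ℝ (fun y => ψ y ^ 2) x (eR x))) +
            2 * radialConst₂ * (ψ 0 ^ 2 * ∫ z in (0 : ℝ)..P, H (F s (meridianPoint (0, z)))))) +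
        deriv η s * ∫ x in zSlab P 0, H (F s x) * ψ x ^ 2 := ⟨_, fun _ => rfl⟩
  have hIint : ∫ s in (-T₁)..0, I s = 0 := by
    refine Eq.trans ?_ hid.symm
    refine intervalIntegral.integral_congr fun s _ => ?_
    rw [hI s]
  -- ### Step 1b: `I` is integrable in time (Fubini on the tested equation)
  have hslice : ∀ s, ∫ x, (deriv H (F s x) * N s x * η s + H (F s x) * deriv η s) *
      (ψ x * periodicWindow P (x 2)) ^ 2 = I s := by
    intro s
    have hiA : Integrable (fun x => deriv H (F s x) * N s x * (ψ x * periodicWindow P (x 2)) ^ 2)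
        (volume : Measure (EuclideanSpace ℝ (Fin 3))) :=
      integrable_testedSlice_periodic hP (hF2 s) (hFa s) (hb1 s) (hN s) hH hψ hψa hψ0
    have hiB : Integrable (fun x => H (F s x) * (ψ x * periodicWindow P (x 2)) ^ 2)
        (volume : Measure (EuclideanSpace ℝ (Fin 3))) := by
      have hc : Continuous fun x => H (F s x) * (ψ x * periodicWindow P (x 2)) ^ 2 :=
        (hHFs s).mul ((hψ.continuous.mul ((contDiff_periodicWindow P (n := 0)).continuous.comp hx2c)).pow 2)
      refine hc.integrable_of_hasCompactSupport ?_
      have h1 : HasCompactSupport fun x => ψ x * periodicWindow P (x 2) :=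
        hasCompactSupport_mul_comp_apply_two hψ0 (A := 2 * P) fun z hz =>
          abs_le_of_periodicWindow_ne_zero_plm hP z hz
      exact (h1.comp_left (g := fun t : ℝ => t ^ 2) (by simp)).mul_left
    have hT := testedSlice_eq_bracket_periodic hP (hF2 s) (hFa s) (hFp s) (hb1 s) (hbdiv s) (hbp s) (hN s)
      hH hψ hψa hψz hρ' hψ1 hψ0 ha.continuous haz hψg
    have hMw := integral_comp_mul_windowSq_eq (H := H) hP (hF2 s).continuous (hFp s) hH.continuous
      hψ.continuous hψz hψ0
    have e : ∫ x, (deriv H (F s x) * N s x * η s + H (F s x) * deriv η s) * (ψ x * periodicWindow P (x 2)) ^ 2 =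
        η s * (∫ x, deriv H (F s x) * N s x * (ψ x * periodicWindow P (x 2)) ^ 2) +
          deriv η s * ∫ x, H (F s x) * (ψ x * periodicWindow P (x 2)) ^ 2 := by
      rw [← MeasureTheory.integral_const_mul, ← MeasureTheory.integral_const_mul,
        ← integral_add (hiA.const_mul _) (hiB.const_mul _)]
      refine integral_congr_ae (ae_of_all _ fun x => ?_)
      ring
    rw [e, hT, hMw, hI s]
  have hIi : IntervalIntegrable I volume (-T₁) 0 := by
    have h := hint.integral_prod_left
    rw [intervalIntegrable_iff_integrableOn_Ioc_of_le ht₁]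
    exact h.congr (ae_of_all _ fun s => hslice s)
  -- ### Step 2: the pointwise-in-time bound on `[−T₁, 0]`
  set A : ℝ → ℝ := fun s => ∫ x in K, H (F s x) with hA
  set L : ℝ := 4 * κ * D ^ 2 * (1 + CΦ ^ 2) + Cax + D' with hL
  set Bd : ℝ → ℝ := fun s => 2 * radialConst₂ * (ψ 0 ^ 2 * ∫ z in (0 : ℝ)..P, H (F s (meridianPoint (0, z))))
    with hBd
  have hA0 : ∀ s, 0 ≤ A s := fun s => integral_nonneg fun x => hH0 _
  -- slab integrals of functions vanishing off the cylinder are integrals over `K`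
  have hslabK : ∀ {f : EuclideanSpace ℝ (Fin 3) → ℝ}, (∀ x, ρ ≤ cylRadius x → f x = 0) →
      ∫ x in zSlab P 0, f x = ∫ x in K, f x := fun hf0 => setIntegral_zSlab_eq_periodBox hf0
  have hbound : ∀ s ∈ Icc (-T₁) 0, η s * Bd s ≤ I s + L * A s := by
    intro s hs
    have hηs := hη01 s
    have hgradFs : Continuous (gradient (F s)) := continuous_gradient_of_contDiff ((hF2 s).of_le one_le_two)
    -- the slice functionals at time `s`
    set G₁ : ℝ := ∫ x in zSlab P 0, deriv (deriv H) (F s x) * ‖gradient (F s) x‖ ^ 2 * ψ x ^ 2 with hG₁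
    set T₁v : ℝ := ∫ x in zSlab P 0, deriv H (F s x) * ⟪gradient (F s) x, gradient (fun y => ψ y ^ 2) x⟫ with hT₁v
    set T₂v : ℝ := ∫ x in zSlab P 0, H (F s x) * ⟪b s x, gradient (fun y => ψ y ^ 2) x⟫ with hT₂v
    set T₃v : ℝ := ∫ x in zSlab P 0, 2 / cylRadius x * (H (F s x) * fderiv ℝ (fun y => ψ y ^ 2) x (eR x))
      with hT₃v
    set Mv : ℝ := ∫ x in zSlab P 0, H (F s x) * ψ x ^ 2 with hMv
    set Gt : ℝ := ∫ x in zSlab P 0, Gw (F s x) * ‖gradient (F s) x‖ ^ 2 * ψ x ^ 2 with hGt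
    set Pv : ℝ := ∫ x in zSlab P 0, H (F s x) * ‖gradient ψ x‖ ^ 2 with hPv
    have hGt0 : 0 ≤ Gt := setIntegral_nonneg (measurableSet_zSlab P 0) fun x _ =>
      mul_nonneg (mul_nonneg (hGw0 _) (sq_nonneg _)) (sq_nonneg _)
    -- the viscous integral splits
    have hiG : IntegrableOn (fun x => deriv (deriv H) (F s x) * ‖gradient (F s) x‖ ^ 2 * ψ x ^ 2)
        (zSlab P 0) volume :=
      integrableOn_zSlab_of_eq_zero_of_le_cylRadius
        (((hH''c.comp (hF2 s).continuous).mul (hgradFs.norm.pow 2)).mul (hψ.continuous.pow 2)) (ρ := ρ)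
        (fun x hx => by simp [hψ0 x hx]) P 0
    have hiT : IntegrableOn (fun x => deriv H (F s x) * ⟪gradient (F s) x, gradient (fun y => ψ y ^ 2) x⟫)
        (zSlab P 0) volume :=
      integrableOn_zSlab_of_eq_zero_of_le_cylRadius ((hH'c.comp (hF2 s).continuous).mul (hgradFs.inner hgradψ2))
        (ρ := ρ) (fun x hx => by
          show deriv H (F s x) * ⟪gradient (F s) x, gradient (fun y => ψ y ^ 2) x⟫ = 0
          rw [hgradψ2_0 x hx, inner_zero_right, mul_zero]) P 0
    have hsplit : ∫ x in zSlab P 0, (deriv (deriv H) (F s x) * ‖gradient (F s) x‖ ^ 2 * ψ x ^ 2 +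
        deriv H (F s x) * ⟪gradient (F s) x, gradient (fun y => ψ y ^ 2) x⟫) = G₁ + T₁v := by
      rw [hG₁, hT₁v, ← integral_add hiG hiT]
    have hIs : I s = η s * (-(G₁ + T₁v) + T₂v + (T₃v + Bd s)) + deriv η s * Mv := by
      rw [hI s, hsplit]
    -- `G₁ = −G̃`
    have hG₁eq : G₁ = -Gt := by
      rw [hG₁, hGt, ← MeasureTheory.integral_neg]
      refine setIntegral_congr_fun (measurableSet_zSlab P 0) fun x _ => ?_
      show deriv (deriv H) (F s x) * ‖gradient (F s) x‖ ^ 2 * ψ x ^ 2 =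
        -(Gw (F s x) * ‖gradient (F s) x‖ ^ 2 * ψ x ^ 2)
      by_cases hx : cylRadius x ≤ ρ
      · rw [hG s hs x hx]; ring
      · rw [hψ0 x (not_le.1 hx).le]; ring
    -- `|T₁| ≤ ¼ G̃ + 4κ P`
    have h1 : |T₁v| ≤ 1 / 4 * Gt + 4 * κ * Pv := by
      have h := abs_viscous_cutoff_term_le_weight_periodic ((hF2 s).of_le one_le_two) hH1 hH0 hGwc hGw0 hκ0 hκ
        hψ' hψ0 (ε := 1 / 4) (by norm_num) P
      rw [← hT₁v, ← hGt, ← hPv, show κ / (1 / 4) = 4 * κ by ring] at h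
      exact h
    -- `|T₂| ≤ ¼ G̃ + 4κ C_Φ² P`
    have h2 : |T₂v| ≤ 1 / 4 * Gt + 4 * κ * (CΦ ^ 2 * Pv) := by
      have h := abs_drift_term_le_weight_periodic hP (hF2 s) (hFp s) (hb1 s) (hbp s) (hΦ1 s) (hΦp s) (hΦz s)
        hCΦ (hΦb s) hH hH0 hGwc hGw0 hκ0 hκ hψ hψz hψ0 ha haz hψg (ε := 1 / 4) (by norm_num)
      rw [← hT₂v, ← hGt, ← hPv, show κ * CΦ ^ 2 / (1 / 4) * Pv = 4 * κ * (CΦ ^ 2 * Pv) by ring] at h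
      exact h
    -- `∫_{slab} H(F)ψ ≤ A`, `M ≤ A`, `P ≤ D² A`
    have hHψ_le : ∫ x in zSlab P 0, H (F s x) * ψ x ≤ A s := by
      rw [hslabK (f := fun x => H (F s x) * ψ x) (fun x hx => by simp [hψ0 x hx])]
      refine setIntegral_mono_on (((hHFs s).mul hψ.continuous).continuousOn.integrableOn_compact hKc)
        ((hHFs s).continuousOn.integrableOn_compact hKc) hKm fun x _ => ?_
      calc H (F s x) * ψ x ≤ H (F s x) * 1 := mul_le_mul_of_nonneg_left (hψ01 x).2 (hH0 _)
        _ = H (F s x) := mul_one _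
    have hMA : Mv ≤ A s := by
      rw [hMv, hslabK (f := fun x => H (F s x) * ψ x ^ 2) (fun x hx => by simp [hψ0 x hx])]
      refine setIntegral_mono_on (((hHFs s).mul (hψ.continuous.pow 2)).continuousOn.integrableOn_compact hKc)
        ((hHFs s).continuousOn.integrableOn_compact hKc) hKm fun x _ => ?_
      have h1 : ψ x ^ 2 ≤ 1 := by have := hψ01 x; nlinarith
      calc H (F s x) * ψ x ^ 2 ≤ H (F s x) * 1 := mul_le_mul_of_nonneg_left h1 (hH0 _)
        _ = H (F s x) := mul_one _
    have hM0 : 0 ≤ Mv := setIntegral_nonneg (measurableSet_zSlab P 0) fun x _ => mul_nonneg (hH0 _) (sq_nonneg _)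
    have hPle : Pv ≤ D ^ 2 * A s := by
      rw [hPv, hslabK (f := fun x => H (F s x) * ‖gradient ψ x‖ ^ 2)
        (fun x hx => by simp [hgradψ0 x hx]), hA, ← MeasureTheory.integral_const_mul]
      have hgc : Continuous (gradient ψ) := continuous_gradient_of_contDiff hψ'
      refine setIntegral_mono_on (((hHFs s).mul (hgc.norm.pow 2)).continuousOn.integrableOn_compact hKc)
        ((continuous_const.mul (hHFs s)).continuousOn.integrableOn_compact hKc) hKm fun x _ => ?_
      have h1 : ‖gradient ψ x‖ ^ 2 ≤ D ^ 2 := pow_le_pow_left₀ (norm_nonneg _) (hψD x) 2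
      calc H (F s x) * ‖gradient ψ x‖ ^ 2 ≤ H (F s x) * D ^ 2 := mul_le_mul_of_nonneg_left h1 (hH0 _)
        _ = D ^ 2 * H (F s x) := by ring
    have hQle : CΦ ^ 2 * Pv ≤ D ^ 2 * CΦ ^ 2 * A s := by
      calc CΦ ^ 2 * Pv ≤ CΦ ^ 2 * (D ^ 2 * A s) := mul_le_mul_of_nonneg_left hPle (sq_nonneg _)
        _ = D ^ 2 * CΦ ^ 2 * A s := by ring
    -- `|T₃| ≤ C_ax A`
    have h3 : |T₃v| ≤ Cax * A s := by
      have hgi : Integrable (fun x => Cax * (H (F s x) * ψ x)) ((volume : Measure (EuclideanSpace ℝ (Fin 3))).restrict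
          (zSlab P 0)) :=
        (integrableOn_zSlab_of_eq_zero_of_le_cylRadius ((hHFs s).mul hψ.continuous) (ρ := ρ)
          (fun x hx => by simp [hψ0 x hx]) P 0).const_mul Cax
      have h := norm_integral_le_of_norm_le (μ := (volume : Measure (EuclideanSpace ℝ (Fin 3))).restrict (zSlab P 0))
        (f := fun x => 2 / cylRadius x * (H (F s x) * fderiv ℝ (fun y => ψ y ^ 2) x (eR x))) hgi
        (ae_of_all _ fun x => (by
          show ‖2 / cylRadius x * (H (F s x) * fderiv ℝ (fun y => ψ y ^ 2) x (eR x))‖ ≤ Cax * (H (F s x) * ψ x)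
          rw [Real.norm_eq_abs, show 2 / cylRadius x * (H (F s x) * fderiv ℝ (fun y => ψ y ^ 2) x (eR x)) =
            H (F s x) * (2 / cylRadius x * fderiv ℝ (fun y => ψ y ^ 2) x (eR x)) by ring, abs_mul,
            abs_of_nonneg (hH0 _)]
          calc H (F s x) * |2 / cylRadius x * fderiv ℝ (fun y => ψ y ^ 2) x (eR x)|
              ≤ H (F s x) * (Cax * ψ x) := mul_le_mul_of_nonneg_left (hψax x) (hH0 _)
            _ = Cax * (H (F s x) * ψ x) := by ring))
      rw [Real.norm_eq_abs] at h
      refine h.trans ?_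
      rw [MeasureTheory.integral_const_mul]
      exact mul_le_mul_of_nonneg_left hHψ_le hCax
    have harith := lower_mass_arith (η := η s) (Bd := Bd s) (I := I s) (G₁ := G₁) (T₁ := T₁v) (T₂ := T₂v)
      (T₃ := T₃v) (M := Mv) (dη := deriv η s) (Gt := Gt) (A := A s) (Y23 := A s) (κ := κ) (D := D)
      (Cax := Cax) (D' := D') (CJ6 := CΦ ^ 2) (P := Pv) (Q := CΦ ^ 2 * Pv)
      hIs hG₁eq hGt0 hηs.1 hηs.2 hκ0 (hA0 s) (hA0 s) hCax (sq_nonneg _) hD'0 h1 h2 h3 hMA hM0 (hηD s) hPle hQle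
    have e : (4 * κ * D ^ 2 + Cax + D') * A s + 4 * κ * D ^ 2 * CΦ ^ 2 * A s = L * A s := by rw [hL]; ring
    linarith [harith, e]
  -- ### Step 3: integrate over `[−T₁, 0]`
  have hAc : Continuous A := continuous_parametric_integral_of_continuous
    (μ := (volume : Measure (EuclideanSpace ℝ (Fin 3)))) (f := fun s x => H (F s x)) hHFc hKc
  have hRc : Continuous fun s => L * A s := continuous_const.mul hAc
  have hmpc : Continuous fun z : ℝ => meridianPoint (0, z) :=
    (contDiff_meridianPoint (n := 0)).continuous.comp (continuous_const.prodMk continuous_id)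
  have hBdc : Continuous Bd := by
    have hjc : Continuous (Function.uncurry fun (s : ℝ) (z : ℝ) => H (F s (meridianPoint (0, z)))) :=
      hHFc.comp (continuous_fst.prodMk (hmpc.comp continuous_snd))
    have h := intervalIntegral.continuous_parametric_intervalIntegral_of_continuous' (μ := (volume : Measure ℝ))
      hjc 0 P
    exact continuous_const.mul (continuous_const.mul h)
  have hηc : Continuous η := hη.continuous
  have hLi : IntervalIntegrable (fun s => η s * Bd s) volume (-T₁) 0 := (hηc.mul hBdc).intervalIntegrable _ _
  have hRi : IntervalIntegrable (fun s => L * A s) volume (-T₁) 0 := hRc.intervalIntegrable _ _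
  have hmono : ∫ s in (-T₁)..0, η s * Bd s ≤ ∫ s in (-T₁)..0, (I s + L * A s) :=
    intervalIntegral.integral_mono_on ht₁ hLi (hIi.add hRi) hbound
  rw [intervalIntegral.integral_add hIi hRi, hIint, zero_add] at hmono
  exact hmono

end LeiRenZhang2019

end Literature.Analysis.FluidPDE

end
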